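import Mathlib
import Literature.Analysis.SpecialFunctions.GaussLegendreQuadrature
import Literature.Analysis.Quadrature.ChebyshevCoefficientsBV
import Literature.Analysis.Quadrature.GaussLegendreAliasing

/-!
# Gauss–Legendre quadrature when `f^{(k)}` is of bounded variation, jumps allowed (Trefethen 2008, Thm. 4.5 (4.13))

**Theorem** [cite: Trefethen2008, Thm. 4.5 (4.13)] (p. 75 loc. cit.; Trefethen writes the rule
with `n + 1` nodes, here `N` is the NUMBER OF NODES as in `gaussLegendreNodes N`, his `n` is
`N - 1`): *let Gauss quadrature be applied to `f ∈ C[-1, 1]`.  If `f, f', …, f^{(k-1)}` are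
absolutely continuous on `[-1, 1]` and `‖f^{(k)}‖_T = V < ∞` for some `k ≥ 1`, then for each
`n ≥ k/2`,* `|I - I_n| ≤ 64 V / (15 π k (2n + 1 - k)^k)` *(with `N = n + 1` nodes:
`64 V / (15 π k (2N - 1 - k)^k)`).*

## What is formalised (hypothesis class) — the Stieltjes generality

The companion file `GaussLegendreBoundedVariation` proves (4.13) for a derivative chain ending in a
Chebyshev-weight-INTEGRABLE `f^{(k+1)}` (so `f^{(k)}` absolutely continuous), with
`V = ∫_0^π |f^{(k+1)}(cos θ)| dθ = ‖f^{(k)}‖_T`, and records that *the Stieltjes generality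
(`f^{(k)}` merely of bounded variation, jumps allowed) is NOT formalised*.  This file supplies it,
for real integrands: a chain `F 0 = f, F 1, …, F k : ℝ → ℝ` with `F i` continuous on `[-1, 1]` and
`F (i+1) = (F i)'` on `(-1, 1)` off a countable set (`i < k`), and `F k` of BOUNDED VARIATION on
`[-1, 1]` — e.g. `f(x) = |x|` with `k = 1`, `F 1 = sign`.  The bound holds with the plain total
variation `V = Var_{[-1,1]} f^{(k)}` (`(eVariationOn (F k) (Icc (-1) 1)).toReal`), which is
`≤ ‖f^{(k)}‖_T` whenever the latter is defined (the weight `(1 - x²)^{-1/2} ≥ 1`), so the displayed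
(4.13) follows.

* `abs_integral_sub_gaussLegendre_le_descFactorial_of_boundedVariationOn`: the form the proof
  gives, `64 V / (15 π k (2N-1)(2N-2)⋯(2N-k))`, `1 ≤ k ≤ 2N - 2`;
* `abs_integral_sub_gaussLegendre_le_of_boundedVariationOn`: (4.13) as displayed;
* `abs_integral_sub_gaussLegendre_le_interval_of_boundedVariationOn`: on `[a, b]` — nodes
  `(b-a)/2 · x + (a+b)/2`, weights `(b-a)/2 · w_x`, bound
  `(b-a)/2 · 64 (((b-a)/2)^k Var_{[a,b]} f^{(k)}) / (15 π k (2N-1-k)^k)`.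

Proof, as loc. cit. and as in the companion file, with the coefficient bound (4.6) in its
bounded-variation form `|a_j| ≤ (2V/π) / (j (j-1) ⋯ (j-k))`, `j ≥ k + 1`
(`norm_chebCoeff_le_of_boundedVariationOn_descFactorial`, file `ChebyshevCoefficientsBV`, from the
Riemann–Stieltjes integration by parts of Montgomery–Vaughan App. A), the aliasing lemma
(`norm_integral_sub_gaussLegendre_le_of_chebCoeff_le`), the telescoped tail
(`tsum_one_div_descFactorial_le`) and `(2N-1) ⋯ (2N-k) ≥ (2N-1-k)^k`; on `[a, b]` the chain is
transported by `t ↦ (b-a)/2 · t + (a+b)/2` and `Var (c · g ∘ φ) ≤ |c| Var g` for monotone affine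
`φ` (`eVariationOn.comp_eq_of_monotoneOn`, `LipschitzOnWith.comp_eVariationOn_le`).

## References

* L. N. Trefethen, *Is Gauss quadrature better than Clenshaw–Curtis?*, SIAM Review **50** (2008)
  67–87, Thm. 4.5, eq. (4.13); Thm. 4.2 (4.6). [cite: Trefethen2008, Thm. 4.5 (4.13)]
* H. L. Montgomery, R. C. Vaughan, *Multiplicative Number Theory I*, CUP 2007, Appendix A
  (Riemann–Stieltjes integration by parts). [cite: MontgomeryVaughan2007, App. A Thm. A.2]

AI-produced formalisation (H21 engines group, seat eng-quad-3, 2026-08-21); no facts, no axioms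
beyond Mathlib's, no `sorry`.
-/

open Set MeasureTheory Filter

open scoped Real Interval

namespace Literature.Analysis.Quadrature

open Literature.Analysis.SpecialFunctions

/-! ### Theorem 4.5 (4.13) on `[-1, 1]`, `f^{(k)}` of bounded variation -/

/-- **Trefethen 2008, Thm. 4.5 (4.13), product form, `f^{(k)}` of bounded variation.**  For the
`N`-point Gauss–Legendre rule, `1 ≤ k ≤ 2N - 2`, and a real `f` with a derivative chain
`F 0 = f, …, F k` (`F i` continuous on `[-1, 1]` and `F (i+1) = (F i)'` on `(-1, 1)` off the
countable set `s` for `i < k`, `F k` of bounded variation on `[-1, 1]`, jumps allowed):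
`|∫_{-1}^{1} f - Σ_x w_x f(x)| ≤ 64 V / (15 π k (2N-1)(2N-2)⋯(2N-k))`, `V = Var_{[-1,1]} F k`.
[cite: Trefethen2008, Thm. 4.5 (4.13)] -/
theorem abs_integral_sub_gaussLegendre_le_descFactorial_of_boundedVariationOn {k : ℕ}
    {F : ℕ → ℝ → ℝ} {s : Set ℝ} (hs : s.Countable)
    (hcont : ∀ i < k, ContinuousOn (F i) (Icc (-1 : ℝ) 1))
    (hder : ∀ i < k, ∀ x ∈ Ioo (-1 : ℝ) 1 \ s, HasDerivAt (F i) (F (i + 1) x) x)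
    (hBV : BoundedVariationOn (F k) (Icc (-1 : ℝ) 1)) (hk : 1 ≤ k) {N : ℕ}
    (hN : k ≤ 2 * N - 2) :
    |(∫ t in (-1 : ℝ)..1, F 0 t) - ∑ x ∈ gaussLegendreNodes N, gaussLegendreWeight N x * F 0 x| ≤
      64 * (eVariationOn (F k) (Icc (-1 : ℝ) 1)).toReal /
        (15 * π * k * ((2 * N - 1).descFactorial k : ℝ)) := by
  have hN2 : 2 ≤ N := by omega
  have hπ := Real.pi_pos
  set V : ℝ := (eVariationOn (F k) (Icc (-1 : ℝ) 1)).toReal with hV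
  have hV0 : 0 ≤ V := ENNReal.toReal_nonneg
  set W : ℝ := 2 / π * V with hW
  have hW0 : 0 ≤ W := by positivity
  set f : ℝ → ℂ := fun x => (F 0 x : ℂ) with hf
  have hfc : ContinuousOn f (Icc (-1 : ℝ) 1) :=
    Complex.continuous_ofReal.comp_continuousOn (hcont 0 (by omega))
  -- (4.6), bounded-variation form: `|a_j| ≤ W / (j (j-1) ⋯ (j-k))` for `j ≥ k + 1`
  have hcoef : ∀ {j : ℕ}, k + 1 ≤ j → ‖chebCoeff f j‖ ≤ W / (j.descFactorial (k + 1) : ℝ) :=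
    fun {j} hj => norm_chebCoeff_le_of_boundedVariationOn_descFactorial hs k hcont hder hBV hj
  -- the summable majorant: (4.6) from the first aliased index `2N` on
  set b : ℕ → ℝ := fun j =>
    if 2 * N ≤ j then W / (j.descFactorial (k + 1) : ℝ) else ‖chebCoeff f j‖ with hb
  have hble : ∀ j, ‖chebCoeff f j‖ ≤ b j := by
    intro j
    simp only [hb]
    split_ifs with h
    · exact hcoef (by omega)
    · exact le_rfl
  have htail := tsum_one_div_descFactorial_le (M := 2 * N) hk (by omega)
  have hbshift : ∀ i, b (i + 2 * N) = W * (1 / ((2 * N + i).descFactorial (k + 1) : ℝ)) := by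
    intro i
    simp only [hb]
    rw [if_pos (by omega), show i + 2 * N = 2 * N + i by ring]
    ring
  have hbs' : Summable fun i => b (i + 2 * N) := by
    simp only [hbshift]
    exact htail.1.mul_left W
  have hbs : Summable b := (summable_nat_add_iff (2 * N)).mp hbs'
  have key := norm_integral_sub_gaussLegendre_le_of_chebCoeff_le hfc hble hbs hN2
  -- the error is real
  have hreal : (((∫ t in (-1 : ℝ)..1, F 0 t) -
      ∑ x ∈ gaussLegendreNodes N, gaussLegendreWeight N x * F 0 x : ℝ) : ℂ) =
      (∫ t in (-1 : ℝ)..1, f t) - ∑ x ∈ gaussLegendreNodes N, (gaussLegendreWeight N x : ℂ) * f x := by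
    simp only [hf, Complex.ofReal_sub, Complex.ofReal_sum, Complex.ofReal_mul,
      intervalIntegral.integral_ofReal]
  rw [← hreal, Complex.norm_real, Real.norm_eq_abs] at key
  have htsum : ∑' i, b (i + 2 * N) = W * ∑' i, 1 / ((2 * N + i).descFactorial (k + 1) : ℝ) := by
    simp only [hbshift]
    exact tsum_mul_left
  refine key.trans ?_
  rw [htsum]
  have hkpos : (0 : ℝ) < k := by exact_mod_cast hk
  have hD : (0 : ℝ) < ((2 * N - 1).descFactorial k : ℝ) := by
    exact_mod_cast Nat.descFactorial_pos.mpr (by omega)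
  calc 32 / 15 * (W * ∑' i, 1 / ((2 * N + i).descFactorial (k + 1) : ℝ))
      ≤ 32 / 15 * (W * (1 / (k * ((2 * N - 1).descFactorial k : ℝ)))) := by
        gcongr
        exact htail.2
    _ = 64 * V / (15 * π * k * ((2 * N - 1).descFactorial k : ℝ)) := by
        rw [hW]
        field_simp
        ring

/-- **Trefethen 2008, Thm. 4.5 (4.13), `f^{(k)}` of bounded variation** (re-indexed: `N` nodes).
For the `N`-point Gauss–Legendre rule, `1 ≤ k ≤ 2N - 2`, and a real `f` with a derivative chain
`F 0 = f, …, F k` (`F i` continuous on `[-1, 1]`, `F (i+1) = (F i)'` on `(-1, 1)` off the countable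
set `s` for `i < k`, `F k` of bounded variation on `[-1, 1]`, jumps allowed):
`|∫_{-1}^{1} f(x) dx - Σ_x w_x f(x)| ≤ 64 V / (15 π k (2N - 1 - k)^k)`, `V = Var_{[-1,1]} F k`
(`≤ ‖f^{(k)}‖_T`). [cite: Trefethen2008, Thm. 4.5 (4.13)] -/
theorem abs_integral_sub_gaussLegendre_le_of_boundedVariationOn {k : ℕ}
    {F : ℕ → ℝ → ℝ} {s : Set ℝ} (hs : s.Countable)
    (hcont : ∀ i < k, ContinuousOn (F i) (Icc (-1 : ℝ) 1))
    (hder : ∀ i < k, ∀ x ∈ Ioo (-1 : ℝ) 1 \ s, HasDerivAt (F i) (F (i + 1) x) x)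
    (hBV : BoundedVariationOn (F k) (Icc (-1 : ℝ) 1)) (hk : 1 ≤ k) {N : ℕ}
    (hN : k ≤ 2 * N - 2) :
    |(∫ t in (-1 : ℝ)..1, F 0 t) - ∑ x ∈ gaussLegendreNodes N, gaussLegendreWeight N x * F 0 x| ≤
      64 * (eVariationOn (F k) (Icc (-1 : ℝ) 1)).toReal /
        (15 * π * k * (2 * N - 1 - k : ℝ) ^ k) := by
  refine (abs_integral_sub_gaussLegendre_le_descFactorial_of_boundedVariationOn hs hcont hder hBV
    hk hN).trans ?_
  have hV0 : 0 ≤ (eVariationOn (F k) (Icc (-1 : ℝ) 1)).toReal := ENNReal.toReal_nonneg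
  have hkpos : (0 : ℝ) < k := by exact_mod_cast hk
  have hbase : (1 : ℝ) ≤ 2 * N - 1 - k := by
    have h : k + 2 ≤ 2 * N := by omega
    have h' : (k : ℝ) + 2 ≤ 2 * N := by exact_mod_cast h
    linarith
  have hpow : (2 * N - 1 - k : ℝ) ^ k ≤ ((2 * N - 1).descFactorial k : ℝ) := by
    have h1 := Nat.pow_sub_le_descFactorial (2 * N - 1) k
    have h2 : (2 * N - 1 - k) ^ k ≤ (2 * N - 1 + 1 - k) ^ k := Nat.pow_le_pow_left (by omega) k
    have h3 : ((2 * N - 1 - k : ℕ) : ℝ) = 2 * N - 1 - k := by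
      rw [Nat.cast_sub (by omega), Nat.cast_sub (by omega)]
      push_cast
      ring
    rw [← h3]
    exact_mod_cast h2.trans h1
  have hP : (0 : ℝ) < (2 * N - 1 - k : ℝ) ^ k := pow_pos (by linarith) k
  exact div_le_div_of_nonneg_left (by positivity)
    (mul_pos (mul_pos (mul_pos (by norm_num) Real.pi_pos) hkpos) hP)
    (mul_le_mul_of_nonneg_left hpow (by positivity))

/-! ### Theorem 4.5 (4.13) on `[a, b]`, `f^{(k)}` of bounded variation -/

/-- **Trefethen 2008, Thm. 4.5 (4.13) on a general interval `[a, b]`, `f^{(k)}` of bounded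
variation** (affine transport `t ↦ (b-a)/2 · t + (a+b)/2`): with nodes `(b-a)/2 · x + (a+b)/2`,
weights `(b-a)/2 · w_x`, `1 ≤ k ≤ 2N - 2`, and a real derivative chain `F 0 = f, …, F k` on
`[a, b]` (`F i` continuous on `[a, b]`, `F (i+1) = (F i)'` on `(a, b)` off the countable set `s` for
`i < k`, `F k` of bounded variation on `[a, b]`, jumps allowed):
`|∫_a^b f - Σ_x (b-a)/2 · w_x f((b-a)/2 · x + (a+b)/2)| ≤
  (b-a)/2 · 64 (((b-a)/2)^k · Var_{[a,b]} F k) / (15 π k (2N-1-k)^k)`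
(`((b-a)/2)^k Var_{[a,b]} F k ≥ Var_{[-1,1]}` of the `k`-th derivative of the transplanted
integrand). [cite: Trefethen2008, Thm. 4.5 (4.13)] -/
theorem abs_integral_sub_gaussLegendre_le_interval_of_boundedVariationOn {k : ℕ}
    {F : ℕ → ℝ → ℝ} {s : Set ℝ} {a b : ℝ} (hab : a < b) (hs : s.Countable)
    (hcont : ∀ i < k, ContinuousOn (F i) (Icc a b))
    (hder : ∀ i < k, ∀ x ∈ Ioo a b \ s, HasDerivAt (F i) (F (i + 1) x) x)
    (hBV : BoundedVariationOn (F k) (Icc a b)) (hk : 1 ≤ k) {N : ℕ} (hN : k ≤ 2 * N - 2) :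
    |(∫ t in a..b, F 0 t) - ∑ x ∈ gaussLegendreNodes N,
        ((b - a) / 2 * gaussLegendreWeight N x) * F 0 ((b - a) / 2 * x + (a + b) / 2)| ≤
      (b - a) / 2 * (64 * (((b - a) / 2) ^ k * (eVariationOn (F k) (Icc a b)).toReal) /
        (15 * π * k * (2 * N - 1 - k : ℝ) ^ k)) := by
  set L : ℝ := (b - a) / 2 with hL
  set c : ℝ := (a + b) / 2 with hc
  have hL0 : 0 < L := by rw [hL]; linarith
  -- the transplanted chain `G i (t) = L^i F i (L t + c)` on `[-1, 1]`
  set G : ℕ → ℝ → ℝ := fun i t => L ^ i * F i (L * t + c) with hG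
  have hIcc : ∀ t ∈ Icc (-1 : ℝ) 1, L * t + c ∈ Icc a b := by
    intro t ht
    rw [hL, hc]
    constructor <;> nlinarith [ht.1, ht.2]
  have hIoo : ∀ t ∈ Ioo (-1 : ℝ) 1, L * t + c ∈ Ioo a b := by
    intro t ht
    rw [hL, hc]
    constructor <;> nlinarith [ht.1, ht.2]
  -- exceptional set pulled back by the affine map
  set s' : Set ℝ := (fun x => (x - c) / L) '' s with hs'
  have hs'c : s'.Countable := hs.image _
  have hGcont : ∀ i < k, ContinuousOn (G i) (Icc (-1 : ℝ) 1) := by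
    intro i hi
    exact continuousOn_const.mul
      ((hcont i hi).comp (by fun_prop : Continuous fun t : ℝ => L * t + c).continuousOn hIcc)
  have hGder : ∀ i < k, ∀ t ∈ Ioo (-1 : ℝ) 1 \ s', HasDerivAt (G i) (G (i + 1) t) t := by
    rintro i hi t ⟨ht, hts⟩
    have hmem : L * t + c ∈ Ioo a b \ s := by
      refine ⟨hIoo t ht, fun h => hts ⟨L * t + c, h, ?_⟩⟩
      field_simp
      ring
    have hlin : HasDerivAt (fun t : ℝ => L * t + c) L t := by
      simpa using ((hasDerivAt_id' t).const_mul L).add_const c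
    have h := ((hder i hi _ hmem).scomp t hlin).const_mul (L ^ i)
    refine h.congr_deriv ?_
    simp only [hG, smul_eq_mul]
    ring
  -- the variation of `G k = L^k · (F k ∘ φ)`, `φ` the increasing affine map onto `[a, b]`
  have himage : (fun t : ℝ => L * t + c) '' Icc (-1 : ℝ) 1 = Icc a b := by
    rw [Set.image_affine_Icc' hL0, show L * (-1 : ℝ) + c = a by rw [hL, hc]; ring,
      show L * (1 : ℝ) + c = b by rw [hL, hc]; ring]
  have hmono : MonotoneOn (fun t : ℝ => L * t + c) (Icc (-1 : ℝ) 1) :=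
    fun x _ y _ hxy => by simpa using mul_le_mul_of_nonneg_left hxy hL0.le
  have hVcomp : eVariationOn (F k ∘ fun t : ℝ => L * t + c) (Icc (-1 : ℝ) 1) =
      eVariationOn (F k) (Icc a b) := by
    rw [eVariationOn.comp_eq_of_monotoneOn (F k) _ hmono, himage]
  have hGk : G k = (fun y : ℝ => (L ^ k : ℝ) • y) ∘ (F k ∘ fun t : ℝ => L * t + c) := by
    funext t
    simp [hG, smul_eq_mul]
  have hVle : eVariationOn (G k) (Icc (-1 : ℝ) 1) ≤
      (‖(L ^ k : ℝ)‖₊ : ENNReal) * eVariationOn (F k) (Icc a b) := by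
    rw [hGk, ← hVcomp]
    exact (lipschitzWith_smul (L ^ k : ℝ)).lipschitzOnWith.comp_eVariationOn_le
      (Set.mapsTo_univ _ _)
  have hfin : (‖(L ^ k : ℝ)‖₊ : ENNReal) * eVariationOn (F k) (Icc a b) ≠ ⊤ :=
    ENNReal.mul_ne_top ENNReal.coe_ne_top hBV
  have hGBV : BoundedVariationOn (G k) (Icc (-1 : ℝ) 1) := ne_top_of_le_ne_top hfin hVle
  have hVreal : (eVariationOn (G k) (Icc (-1 : ℝ) 1)).toReal ≤
      L ^ k * (eVariationOn (F k) (Icc a b)).toReal := by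
    have h := ENNReal.toReal_mono hfin hVle
    rw [ENNReal.toReal_mul, ENNReal.coe_toReal, coe_nnnorm,
      Real.norm_of_nonneg (pow_nonneg hL0.le k)] at h
    exact h
  have key := abs_integral_sub_gaussLegendre_le_of_boundedVariationOn (F := G) hs'c hGcont hGder
    hGBV hk hN
  have hkpos : (0 : ℝ) < k := by exact_mod_cast hk
  have hbase : (0 : ℝ) < 2 * N - 1 - k := by
    have h : k + 2 ≤ 2 * N := by omega
    have h' : (k : ℝ) + 2 ≤ 2 * N := by exact_mod_cast h
    linarith
  have hden : (0 : ℝ) < 15 * π * k * (2 * N - 1 - k : ℝ) ^ k :=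
    mul_pos (mul_pos (mul_pos (by norm_num) Real.pi_pos) hkpos) (pow_pos hbase k)
  have key' : |(∫ t in (-1 : ℝ)..1, G 0 t) -
      ∑ x ∈ gaussLegendreNodes N, gaussLegendreWeight N x * G 0 x| ≤
        64 * (L ^ k * (eVariationOn (F k) (Icc a b)).toReal) /
          (15 * π * k * (2 * N - 1 - k : ℝ) ^ k) :=
    key.trans (div_le_div_of_nonneg_right (mul_le_mul_of_nonneg_left hVreal (by norm_num))
      hden.le)
  have hG0 : ∀ t : ℝ, G 0 t = F 0 (L * t + c) := by
    intro t
    simp [hG]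
  -- the affine change of variables in the integral and in the sum
  have hint2 : (∫ t in a..b, F 0 t) = L * ∫ t in (-1 : ℝ)..1, G 0 t := by
    have h := intervalIntegral.integral_comp_mul_add (fun t : ℝ => F 0 t) hL0.ne' c
      (a := -1) (b := 1)
    beta_reduce at h
    rw [show L * (-1 : ℝ) + c = a by rw [hL, hc]; ring,
      show L * (1 : ℝ) + c = b by rw [hL, hc]; ring] at h
    simp_rw [hG0]
    rw [h, smul_eq_mul, mul_inv_cancel_left₀ hL0.ne']
  have hsum2 : ∑ x ∈ gaussLegendreNodes N,
      ((b - a) / 2 * gaussLegendreWeight N x) * F 0 ((b - a) / 2 * x + (a + b) / 2) =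
        L * ∑ x ∈ gaussLegendreNodes N, gaussLegendreWeight N x * G 0 x := by
    rw [Finset.mul_sum]
    refine Finset.sum_congr rfl fun x _ => ?_
    rw [hG0, hL, hc]
    ring
  rw [hint2, hsum2, ← mul_sub, abs_mul, abs_of_pos hL0]
  exact mul_le_mul_of_nonneg_left key' hL0.le

end Literature.Analysis.Quadrature
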